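import Summits.HodgeConjecture.HodgeConjecture.Theses.HolomorphicityRate
import Literature.Geometry.Kaehler.NearlyHolomorphicCycleSupport
import Literature.Geometry.Riemannian.RiemannianMetricExists
import Literature.AlgebraicGeometry.HodgeTheory.HodgeModelConnected
import Literature.AlgebraicGeometry.HodgeTheory.LefschetzOneOneHolds
import Literature.AlgebraicGeometry.HodgeTheory.MiddleDimensionReductionHolds
import Literature.AlgebraicTopology.SingularHomology.CohomologyClopenPieces
import Summits.HodgeConjecture.HodgeConjecture.Theorems.HolomorphicityRateRateGapExistsHolomorphicCycleSupport
import Summits.HodgeConjecture.HodgeConjecture.Theorems.HolomorphicityRateRateGapOfHodgeMiddle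
import Summits.HodgeConjecture.HodgeConjecture.Theorems.HolomorphicityRateRateGapOfHodgePrimitive
import Summits.HodgeConjecture.HodgeConjecture.Theorems.LinearSystemTorelliTranscendentalOrSupportedStubOfMiddleOfHodgeEffectiveAbstract
import HarnessLib

/-!
# Crux `RateGap` (stmt-HodgeConjecture-10762) — line `registered` (`Lines/birth.lean`), RESHAPED by the lead:
# CANCELLATION — a holomorphic cycle support of codimension `p`, and the Hodge core = item 1081

**Lead c4 reshape (2026-08-17).** The one open stub of skeleton v5 (`stub_hodgePrimitiveMiddle`, the
Hodge conjecture for primitive middle-dimensional rational classes, kernel-equivalent to the summit)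
is replaced by `stub_middleDivisorSupport`, whose statement is the SIGNATURE OF THE EXISTING LEDGER
ITEM stmt-HodgeConjecture-1081 (`MiddleDivisorSupport`, crux of routes `NodalSupport` r2 /
`LinearSystemTorelli` r6, support of `LimitExtension`) VERBATIM: every rational `(p,p)` class in the
middle degree of a smooth projective `2p`-fold, `p ≥ 1`, lies in `N¹H²ᵖ` (is supported on a divisor).
The tree certifies item 1081 equivalent to `_root_.HodgeConjecture`
(`middleDivisorSupport_iff_hodgeConjecture`, `hodgeConjecture_of_middleDivisorSupport`: Thomas 2005
Thm. 1 in divisor-support form — divisor induction, Lefschetz pencils, hard Lefschetz, all closed items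
of route `LinearSystemTorelli`), hence equivalent to the c3 stub; `hodgePrimitiveMiddle_of_stub` below
is the sorry-free link, and `RateGap_of` is the unchanged cancellation chain
`1081 ⟹ HC ⟹ primitive middle ⟹ middle ⟹ below middle ⟹ cancellation ⟹ RateGap`, sorry-free but for
`stub_middleDivisorSupport`. So the crux AS TYPED is closed modulo exactly one existing open item, on
which it now hinges (`blocked-on: stmt-HodgeConjecture-1081`); certificate file
`Theorems/HolomorphicityRateRateGapOfMiddleDivisorSupport.lean` (`rateGap_of_middleDivisorSupport`,
`hodgePrimitiveMiddle_iff_middleDivisorSupport`). History of the line below.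

Route `HolomorphicityRate`, R1 = `RateGap` ("Hodge ⟹ holomorphicity rate > p"): for every rational
`(p,p)` class `c` on a smooth projective `X` (in a Hodge model `A = X^an`) a ray `γ_k = m•c + a_k•hp`
(`m ≥ 1`, `hp` rational algebraic, `a_k ≤ C k^p`) carrying, for infinitely many `k`, a nearly
holomorphic cycle support of power super-threshold defect `≤ C' k^{-(p+δ)}`, `δ > 0`.

The birth skeleton cut the exponent claim into "margin" + "amplification"; both halves are HC-hard as
filed (the margin stub is the crux with a little-o defect, the amplification stub carries the crux's
conclusion verbatim, and a little-o margin does not re-index into a power). The lead's reshape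
(same line, same namespace, same `RateGap_of` by name) uses instead the freedom the crux leaves in
the ray: `hp` is ANY rational algebraic class, so once `c ∈ algebraicClasses X p` one may take
`hp := -c`, `m := 1`, `a_k := min k 1 ≤ k^p` — then `γ_k = c - c = 0` for every `k ≥ 1`, its
pull-back dies everywhere, and the support clause asks only for SOME holomorphic cycle support of
codimension `p` in `X^an` (defect `0 ≤ C' k^{-(p+δ)}` with `C' = 0`). This splits the crux exactly
into

* `stub_existsHolomorphicCycleSupport` (G, pure complex geometry): every Hodge model of a smooth
  projective `n`-fold carries, for `0 < p ≤ n`, a closed connected complex submanifold of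
  codimension `p` presented by regular holomorphic equations — a nearly holomorphic cycle support of
  defect `0` (hence `≤ t` for every `t`) with empty bad set (`Sg = ∅`). Mechanism: a connected
  component of the level `Z_p = {u₀ = ⋯ = u_{p-1} = 0}` of the tree's transverse flag of hyperplane
  sections read on the analytification (`exists_transverse_flag`, `RegularEquations.locus`,
  `IsRegularPointOfCodim.isNearlyHolomorphicRegularPoint`). Provable now.
* `stub_hodgePrimitiveMiddle` (H, the Hodge core — RESHAPED twice by lead c3): on a smooth projective
  variety of EVEN dimension `2m`, `2 ≤ m`, every rational `(m,m)`-class which is PRIMITIVE for a hard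
  Lefschetz datum `Λ` (`[H] ∪ c = 0`) is algebraic — the Hodge conjecture for primitive
  middle-dimensional classes, to which the whole conjecture (hence the earlier stubs
  `stub_hodgeBelowMiddle` of leads c1/c2, `2 ≤ p ≤ n/2`, and `stub_hodgeMiddle` of the first c3
  reshape, `2p = n`) reduces INSIDE THE TREE: `hodgeMiddle_of_stub` (Lefschetz decomposition step
  with rationality / Hodge types from the fields of `HardLefschetzNFold`; Lefschetz-pencil step below
  the middle `mem_algebraicClasses_of_two_mul_le`, de Cataldo–Migliorini 2009 / Thomas 2005,
  discharged; hard Lefschetz above the middle; Lefschetz `(1,1)`; top degree — Theorems file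
  `HolomorphicityRateRateGapOfHodgePrimitive`) and `hodgeBelowMiddle_of_stub` (BFNP 2009 Lemma 48,
  `middleDimensionReduction_holds` — Theorems file `HolomorphicityRateRateGapOfHodgeMiddle`), both
  sorry-free; for the further fold to every codimension, `mem_algebraicClasses_of_stub`. `p = 0` needs
  no algebraicity at all (`S = X^an` has empty complement, `rateGap_conclusion_of_eq_zero`). Open
  problem; the crux is HC-hard exactly here and only from above (HC ⟹ RateGap by this file;
  RateGap ∧ SuperThresholdRigidity ⟹ HC by the route's `closes`); all three stubs are equivalent to
  `_root_.HodgeConjecture` (certificates `hodgeConjecture_iff_hodgeBelowMiddle`,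
  `hodgeConjecture_iff_hodgeMiddle`, `hodgeConjecture_iff_hodgePrimitiveMiddle`).
* `RateGap_of_stubs` (sorry-free composition, crux unfolded verbatim) and the skeleton theorem
  `RateGap_of : HolomorphicityRate.RateGap := RateGap_of_stubs stub_G (hodgeBelowMiddle_of_stub
  (hodgeMiddle_of_stub (hodgePrimitiveMiddle_of_stub stub_middleDivisorSupport)))` (crux BY NAME;
  the only sorry is `stub_middleDivisorSupport` = item stmt-HodgeConjecture-1081).

Disproof used: none — the crux has no `Disproof.lean`, no `_false_without_` theorem, no landed
`Negative/` lemma (`ledger crux ls`, 2026-08-17T10:25Z). Dead lines: none recorded.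
-/

set_option linter.dupNamespace false

noncomputable section

namespace Summit.HodgeConjecture.HodgeConjecture.Cruxes.RateGap.Birth

open scoped Manifold ContDiff Topology
open Set Filter
open Literature.AlgebraicGeometry.HodgeTheory Literature.AlgebraicGeometry.Motives
  Literature.AlgebraicTopology.SingularHomology Literature.Geometry.Kaehler

/-- **Stub G — `existsHolomorphicCycleSupport` (pure complex geometry).** For `X` smooth projective
of dimension `n`, `0 < p ≤ n`, every Hodge model `A` (`X^an`), every Riemannian metric `g` on the real
tangent bundle of `X^an` and every `t`, there is a closed `S ⊆ X^an` which is a nearly holomorphic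
cycle support of codimension `p` and defect `≤ t` with EMPTY bad set: `S` closed and connected, and
near each of its points the regular zero set of `p` holomorphic functions (so the tangent planes are
complex subspaces, defect `0 ≤ |t|`). Intended witness: a connected component of the codimension-`p`
level of the transverse flag of hyperplane sections of `X ↪ ℙᴺ` read on `X^an`
(`Literature.AlgebraicGeometry.HodgeTheory.exists_transverse_flag`, Bertini + GAGA §2 n°6), via
`RegularEquations.locus` / `exists_straightening` and
`IsRegularPointOfCodim.isNearlyHolomorphicRegularPoint`. Size M. LANDED (p143821):
`Summit.HodgeConjecture.HodgeConjecture.Theorems.stub_existsHolomorphicCycleSupport`, file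
`Theorems/HolomorphicityRateRateGapExistsHolomorphicCycleSupport.lean`. -/
theorem stub_existsHolomorphicCycleSupport : ∀ (n p : ℕ) (X : Literature.AlgebraicGeometry.Motives.SchemeOver ℂ), Literature.AlgebraicGeometry.Motives.IsSmoothProjective n X → p ≤ n → 0 < p → ∀ (A : Literature.AlgebraicGeometry.HodgeTheory.HodgeModel n X) (g : Bundle.RiemannianMetric (fun x : A.carrier => TangentSpace 𝓘(ℝ, A.model) x)) (t : ℝ), ∃ S : Set A.carrier, Literature.Geometry.Kaehler.IsNearlyHolomorphicCycleSupport g p t S ∅ :=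
  Summit.HodgeConjecture.HodgeConjecture.Theorems.stub_existsHolomorphicCycleSupport

/-- **Former stub H — `hodgePrimitiveMiddle` (the Hodge core of the crux, RESHAPED twice by lead c3: to
the middle dimension, then to PRIMITIVE classes; derived by lead c4 from the reshaped stub
`stub_middleDivisorSupport`).** For `X` smooth projective of EVEN dimension `2m` with
`2 ≤ m`, every hard Lefschetz datum `Λ` (`[H] = Λ.hyperplaneClass`, the class of a hyperplane section
with its hard Lefschetz package, `nonempty_hardLefschetzNFold_holds`) and every Hodge model `A`: a
rational class `c ∈ H^{2m}(X(ℂ); ℂ)` of type `(m,m)` which is PRIMITIVE, `[H] ∪ c = 0`, is algebraic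
(`c ∈ algebraicClasses X m = Nᵐ H^{2m}`). This is the Hodge conjecture for primitive
middle-dimensional classes, to which the whole conjecture reduces INSIDE THE TREE
(`Theorems/HolomorphicityRateRateGapOfHodgePrimitive`: first step of the Lefschetz decomposition
with rationality and Hodge types from the fields of `HardLefschetzNFold`, the Lefschetz-pencil step
below the middle `mem_algebraicClasses_of_two_mul_le` — de Cataldo–Migliorini 2009 / Thomas 2005,
discharged —, hard Lefschetz above the middle, Lefschetz `(1,1)`, top degree; certificate
`hodgeConjecture_iff_hodgePrimitiveMiddle`). The earlier stubs `stub_hodgeBelowMiddle` (leads c1/c2: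
`2 ≤ p ≤ n/2`) and `stub_hodgeMiddle` (c3, first reshape: `2p = n`, BFNP 2009 Lemma 48
`middleDimensionReduction_holds`) follow from it (`hodgeMiddle_of_stub`, `hodgeBelowMiddle_of_stub`
below, sorry-free) and imply it, so all three are equivalent to `_root_.HodgeConjecture`. Open problem
(Deligne 2000); known for special `X` only, never for all `X`. Size: the summit.
[cite: KerrPearlstein2011, §3.1] [cite: Thomas2005Nodes, Prop. 2] [cite: BrosnanFangNiePearlstein2009, §6 Lemma 48]

**Lead c4:** no longer a stub — this theorem derives it, sorry-free, from the reshaped stub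
`stub_middleDivisorSupport` (= item stmt-HodgeConjecture-1081) through the Hodge conjecture
(`hodgeConjecture_of_middleDivisorSupport`, then `hodgePrimitiveMiddle_of_hodgeConjecture`). -/
theorem hodgePrimitiveMiddle_of_stub
    (hMid : ∀ ⦃p : ℕ⦄ ⦃X : Literature.AlgebraicGeometry.Motives.SchemeOver ℂ⦄, 1 ≤ p → Literature.AlgebraicGeometry.Motives.IsSmoothProjective (2 * p) X → ∀ c : Literature.AlgebraicGeometry.HodgeTheory.complexBetti X (2 * p), Literature.AlgebraicGeometry.HodgeTheory.IsRationalClass c → Literature.AlgebraicGeometry.HodgeTheory.IsOfHodgeType (2 * p) X (2 * p) p p c → c ∈ Literature.AlgebraicGeometry.HodgeTheory.supportedClasses X (2 * p) 1) :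
    ∀ (m : ℕ) (X : Literature.AlgebraicGeometry.Motives.SchemeOver ℂ), Literature.AlgebraicGeometry.Motives.IsSmoothProjective (2 * m) X → 2 ≤ m → ∀ (Λ : Literature.AlgebraicGeometry.HodgeTheory.HardLefschetzNFold (2 * m) X) (A : Literature.AlgebraicGeometry.HodgeTheory.HodgeModel (2 * m) X) (c : Literature.AlgebraicGeometry.HodgeTheory.complexBetti X (2 * m)), Literature.AlgebraicGeometry.HodgeTheory.IsRationalClass c → A.pullback (2 * m) c ∈ A.hodgePQ (2 * m) m m → Literature.Geometry.Kaehler.lefschetzOperator Λ.hyperplaneClass (Literature.AlgebraicGeometry.HodgeTheory.two_add_two_mul m) c = 0 → c ∈ Literature.AlgebraicGeometry.HodgeTheory.algebraicClasses X m :=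
  Summit.HodgeConjecture.HodgeConjecture.Theorems.hodgePrimitiveMiddle_of_hodgeConjecture
    (Summit.HodgeConjecture.HodgeConjecture.Theorems.hodgeConjecture_of_middleDivisorSupport hMid)

/-- **Stub — `middleDivisorSupport` (the Hodge core of the crux, RESHAPED by lead c4 onto the EXISTING
ledger item stmt-HodgeConjecture-1081; this statement is that item's signature VERBATIM).** Every
rational `(p,p)` class in the MIDDLE degree of a smooth projective variety of even dimension `2p`
(`p ≥ 1`) is supported on a divisor: `c ∈ supportedClasses X (2p) 1 = N¹H^{2p}` (vanishes on the
complement of some Zariski-closed subset of codimension `≥ 1`). Sharp printed form (Thomas 2005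
Thm. 1): supported on a NODAL hypersurface section `D ∈ |O_X(N)|` for some `N` — EQUIVALENT to the
Hodge conjecture; in the tree `middleDivisorSupport_iff_hodgeConjecture` (divisor induction via
Deligne Hodge III 8.2.7/8.2.8 and Gysin lifts, Lefschetz pencils below the middle, hard Lefschetz above
it — all closed items of route `LinearSystemTorelli`; converse `Nᵖ ⊆ N¹`). Known for `p = 1`
(Lefschetz `(1,1)`) and for special `X`; open in general. It is the crux decl
`NodalSupport.MiddleDivisorSupport` / `LinearSystemTorelli.MiddleDivisorSupport` of item 1081, whose own
lead registered a 7-stub line at 2026-08-17T09:59Z; this line does not re-prove it — the crux `RateGap`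
as typed hinges on that item. Size: the summit.
[cite: Thomas2005Nodes, Thm. 1 and Prop. 2] [cite: GrothendieckTopology1969, §1]
[cite: KerrPearlstein2011, Conj. 41 and Thm. 42] -/
theorem stub_middleDivisorSupport : ∀ ⦃p : ℕ⦄ ⦃X : Literature.AlgebraicGeometry.Motives.SchemeOver ℂ⦄, 1 ≤ p → Literature.AlgebraicGeometry.Motives.IsSmoothProjective (2 * p) X → ∀ c : Literature.AlgebraicGeometry.HodgeTheory.complexBetti X (2 * p), Literature.AlgebraicGeometry.HodgeTheory.IsRationalClass c → Literature.AlgebraicGeometry.HodgeTheory.IsOfHodgeType (2 * p) X (2 * p) p p c → c ∈ Literature.AlgebraicGeometry.HodgeTheory.supportedClasses X (2 * p) 1 := by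
  sorry

/-- **The middle stub of the first reshape from stub H** (`hodgeMiddle_of_hodgePrimitiveMiddle`,
Theorems file `HolomorphicityRateRateGapOfHodgePrimitive`: Lefschetz decomposition step + pencil step
+ hard Lefschetz, by strong induction on the dimension). Sorry-free. [cite: KerrPearlstein2011, §3.1] -/
theorem hodgeMiddle_of_stub
    (hP : ∀ (m : ℕ) (X : Literature.AlgebraicGeometry.Motives.SchemeOver ℂ), Literature.AlgebraicGeometry.Motives.IsSmoothProjective (2 * m) X → 2 ≤ m → ∀ (Λ : Literature.AlgebraicGeometry.HodgeTheory.HardLefschetzNFold (2 * m) X) (A : Literature.AlgebraicGeometry.HodgeTheory.HodgeModel (2 * m) X) (c : Literature.AlgebraicGeometry.HodgeTheory.complexBetti X (2 * m)), Literature.AlgebraicGeometry.HodgeTheory.IsRationalClass c → A.pullback (2 * m) c ∈ A.hodgePQ (2 * m) m m → Literature.Geometry.Kaehler.lefschetzOperator Λ.hyperplaneClass (Literature.AlgebraicGeometry.HodgeTheory.two_add_two_mul m) c = 0 → c ∈ Literature.AlgebraicGeometry.HodgeTheory.algebraicClasses X m) :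
    ∀ (m : ℕ) (X : Literature.AlgebraicGeometry.Motives.SchemeOver ℂ), Literature.AlgebraicGeometry.Motives.IsSmoothProjective (2 * m) X → 2 ≤ m → ∀ (A : Literature.AlgebraicGeometry.HodgeTheory.HodgeModel (2 * m) X) (c : Literature.AlgebraicGeometry.HodgeTheory.complexBetti X (2 * m)), Literature.AlgebraicGeometry.HodgeTheory.IsRationalClass c → A.pullback (2 * m) c ∈ A.hodgePQ (2 * m) m m → c ∈ Literature.AlgebraicGeometry.HodgeTheory.algebraicClasses X m :=
  Summit.HodgeConjecture.HodgeConjecture.Theorems.hodgeMiddle_of_hodgePrimitiveMiddle hP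

/-- **The earlier stub `stub_hodgeBelowMiddle` (HC for `2 ≤ p ≤ n/2`, leads c1/c2) from the middle
stub**, by the tree's reduction of the Hodge conjecture to the middle dimension
(`hodgeBelowMiddle_of_hodgeMiddle`, Theorems file `HolomorphicityRateRateGapOfHodgeMiddle`:
Brosnan–Fang–Nie–Pearlstein 2009 Lemma 48 = `middleDimensionReduction_holds`). Sorry-free.
[cite: BrosnanFangNiePearlstein2009, §6 Lemma 48] -/
theorem hodgeBelowMiddle_of_stub
    (hM : ∀ (m : ℕ) (X : Literature.AlgebraicGeometry.Motives.SchemeOver ℂ), Literature.AlgebraicGeometry.Motives.IsSmoothProjective (2 * m) X → 2 ≤ m → ∀ (A : Literature.AlgebraicGeometry.HodgeTheory.HodgeModel (2 * m) X) (c : Literature.AlgebraicGeometry.HodgeTheory.complexBetti X (2 * m)), Literature.AlgebraicGeometry.HodgeTheory.IsRationalClass c → A.pullback (2 * m) c ∈ A.hodgePQ (2 * m) m m → c ∈ Literature.AlgebraicGeometry.HodgeTheory.algebraicClasses X m) :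
    ∀ (n p : ℕ) (X : Literature.AlgebraicGeometry.Motives.SchemeOver ℂ), Literature.AlgebraicGeometry.Motives.IsSmoothProjective n X → 2 ≤ p → 2 * p ≤ n → ∀ (A : Literature.AlgebraicGeometry.HodgeTheory.HodgeModel n X) (c : Literature.AlgebraicGeometry.HodgeTheory.complexBetti X (2 * p)), Literature.AlgebraicGeometry.HodgeTheory.IsRationalClass c → A.pullback (2 * p) c ∈ A.hodgePQ (2 * p) p p → c ∈ Literature.AlgebraicGeometry.HodgeTheory.algebraicClasses X p :=
  Summit.HodgeConjecture.HodgeConjecture.Theorems.hodgeBelowMiddle_of_hodgeMiddle hM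

/-- **Algebraicity of rational `(p,p)`-classes in every positive codimension, from stub H and the
tree.** Given stub H (`2 ≤ p`, `2p ≤ n`), a rational class of type `(p,p)` in a Hodge model with
`0 < p ≤ n` is algebraic: `p = 1` is the rational Lefschetz `(1,1)` theorem
(`lefschetzOneOne_rational_holds`, Voisin I Thm. 11.30); `p = n` is the top degree
(`mem_algebraicClasses_of_degree_top`); `2 ≤ p ≤ n/2` is H; and for `n < 2p < 2n` hard Lefschetz
(`HardLefschetzNFold.mem_algebraicClasses_of_lt_holds`: `L^{2p-n} : H^{2(n-p)} ≅ H^{2p}` maps rational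
`(n-p,n-p)`-classes onto rational `(p,p)`-classes and preserves algebraicity) reduces to codimension
`n - p`, which is `1` (Lefschetz) or in H's range. [cite: VoisinHodgeI2002, Thm. 6.25 and Thm. 11.30]
[cite: KerrPearlstein2011, §3.1] -/
theorem mem_algebraicClasses_of_stub
    (hH : ∀ (n p : ℕ) (X : Literature.AlgebraicGeometry.Motives.SchemeOver ℂ), Literature.AlgebraicGeometry.Motives.IsSmoothProjective n X → 2 ≤ p → 2 * p ≤ n → ∀ (A : Literature.AlgebraicGeometry.HodgeTheory.HodgeModel n X) (c : Literature.AlgebraicGeometry.HodgeTheory.complexBetti X (2 * p)), Literature.AlgebraicGeometry.HodgeTheory.IsRationalClass c → A.pullback (2 * p) c ∈ A.hodgePQ (2 * p) p p → c ∈ Literature.AlgebraicGeometry.HodgeTheory.algebraicClasses X p)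
    {n p : ℕ} {X : Literature.AlgebraicGeometry.Motives.SchemeOver ℂ}
    (hX : Literature.AlgebraicGeometry.Motives.IsSmoothProjective n X) (hpn : p ≤ n) (hp0 : 0 < p)
    (A : Literature.AlgebraicGeometry.HodgeTheory.HodgeModel n X)
    (c : Literature.AlgebraicGeometry.HodgeTheory.complexBetti X (2 * p))
    (hc : Literature.AlgebraicGeometry.HodgeTheory.IsRationalClass c)
    (hpp : A.pullback (2 * p) c ∈ A.hodgePQ (2 * p) p p) :
    c ∈ Literature.AlgebraicGeometry.HodgeTheory.algebraicClasses X p := by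
  -- the two codimensions the tree settles directly
  by_cases h1 : p = 1
  · subst h1
    exact lefschetzOneOne_rational_holds hX c hc ⟨A, hpp⟩
  by_cases h2 : p = n
  · subst h2
    exact mem_algebraicClasses_of_degree_top hX hp0 c
  -- at or below the middle: stub H
  by_cases h3 : 2 * p ≤ n
  · exact hH n p X hX (by omega) h3 A c hc hpp
  -- above the middle: hard Lefschetz down to codimension `l = n - p`, which is `1` or in H's range
  have key : ∀ l : ℕ, l = n - p → ∀ c' : Literature.AlgebraicGeometry.HodgeTheory.complexBetti X (2 * l),
      Literature.AlgebraicGeometry.HodgeTheory.IsRationalClass c' →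
        Literature.AlgebraicGeometry.HodgeTheory.IsOfHodgeType n X (2 * l) l l c' →
          c' ∈ Literature.AlgebraicGeometry.HodgeTheory.algebraicClasses X l := by
    intro l hl c' hc' hpq'
    by_cases h4 : l = 1
    · subst h4
      exact lefschetzOneOne_rational_holds hX c' hc' hpq'
    · obtain ⟨A', hA'⟩ := hpq'
      exact hH n l X hX (by omega) (by omega) A' c' hc' hA'
  exact HardLefschetzNFold.mem_algebraicClasses_of_lt_holds hX (by omega) (key (n - p) rfl) c hc ⟨A, hpp⟩

/-- **The crux's conclusion in codimension `p = 0`** (no algebraicity needed): `S = X^an` (connected,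
`HodgeModel.connectedSpace_carrier`; every point regular of real codimension `0`, no equations),
`Sg = ∅`, `m = 1`, `hp = 0`, `a = 0`, `δ = 1`, `C' = 0`; the complement of `S` is empty, so every
class dies on it (`isZero_singularCohomology_of_isEmpty`). Same construction as the landed
`universalRateOne_of_eq_zero`. [folklore] -/
theorem rateGap_conclusion_of_eq_zero (n p : ℕ) (X : Literature.AlgebraicGeometry.Motives.SchemeOver ℂ)
    (hX : Literature.AlgebraicGeometry.Motives.IsSmoothProjective n X) (hp0 : p = 0)
    (A : Literature.AlgebraicGeometry.HodgeTheory.HodgeModel n X)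
    (c : Literature.AlgebraicGeometry.HodgeTheory.complexBetti X (2 * p)) :
    ∃ (g : Bundle.ContMDiffRiemannianMetric 𝓘(ℝ, A.model) ((⊤ : ℕ∞) : WithTop ℕ∞) A.model (fun x : A.carrier => TangentSpace 𝓘(ℝ, A.model) x)) (m : ℕ) (hp : Literature.AlgebraicGeometry.HodgeTheory.complexBetti X (2 * p)) (C : ℝ) (a : ℕ → ℕ) (δ C' : ℝ), 0 < m ∧ Literature.AlgebraicGeometry.HodgeTheory.IsRationalClass hp ∧ hp ∈ Literature.AlgebraicGeometry.HodgeTheory.algebraicClasses X p ∧ (∀ k, (a k : ℝ) ≤ C * (k : ℝ) ^ p) ∧ 0 < δ ∧ ∃ᶠ k : ℕ in Filter.atTop, ∃ S Sg : Set A.carrier, (IsClosed S ∧ IsClosed Sg ∧ Sg ⊆ S ∧ IsConnected (S \ Sg) ∧ (∀ x ∈ Sg, Literature.Geometry.Kaehler.IsAnalyticSetAt 𝓘(ℂ, A.model) S x) ∧ (∃ T : Set A.carrier, Sg ⊆ T ∧ (Literature.Geometry.Kaehler.IsAnalyticSet 𝓘(ℂ, A.model) T ∧ ∀ x ∈ Literature.Geometry.Kaehler.regularLocus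 𝓘(ℂ, A.model) T, ∀ q : ℕ, Literature.Geometry.Kaehler.IsRegularPointOfCodim 𝓘(ℂ, A.model) T q x → p + 1 ≤ q)) ∧ (∀ x ∈ S \ Sg, ∃ U : Set A.carrier, IsOpen U ∧ x ∈ U ∧ ∃ f : A.carrier → (Fin (2 * p) → ℝ), ContMDiffOn 𝓘(ℝ, A.model) 𝓘(ℝ, Fin (2 * p) → ℝ) 1 f U ∧ S ∩ U = U ∩ f ⁻¹' {0} ∧ Function.Surjective (mfderiv 𝓘(ℝ, A.model) 𝓘(ℝ, Fin (2 * p) → ℝ) f x) ∧ ∀ v : TangentSpace 𝓘(ℝ, A.model) x, mfderiv 𝓘(ℝ, A.model) 𝓘(ℝ, Fin (2 * p) → ℝ) f x v = 0 → ∃ w : TangentSpace 𝓘(ℝ, A.model) x, mfderiv 𝓘(ℝ, A.model) 𝓘(ℝ, Fin (2 * p) → ℝ) f x w = 0 ∧ g.inner x (Literature.Geometry.Kaehler.tangentJ A.model x v - w) (Literature.Geometry.Kaehler.tangentJ A.model x v - w) ≤ (C' * (k : ℝ) ^ (-((p : ℝ) + δ))) ^ 2 * g.inner x v v)) ∧ Literature.AlgebraicTopology.SingularHomology.singularCohomology.map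 ℂ ℂ (⟨Subtype.val, continuous_subtype_val⟩ : C({x : A.carrier // x ∉ S}, A.carrier)) (2 * p) (A.pullback (2 * p) (((m : ℂ) • c + ((a k : ℕ) : ℂ) • hp))) = 0 := by
  subst hp0
  haveI : ConnectedSpace A.carrier := A.connectedSpace_carrier hX
  obtain ⟨g⟩ := Literature.Geometry.Riemannian.nonempty_contMDiffRiemannianMetric
    (I := 𝓘(ℝ, A.model)) (M := A.carrier)
  refine ⟨g, 1, 0, 0, fun _ => 0, 1, 0, one_pos, IsRationalClass.zero, Submodule.zero_mem _,
    fun k => by simp, one_pos, Filter.Eventually.frequently (Filter.Eventually.of_forall fun k => ⟨Set.univ, ∅, ?_, ?_⟩)⟩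
  · refine ⟨isClosed_univ, isClosed_empty, Set.empty_subset _, ?_, fun x hx => hx.elim,
      ⟨∅, Set.empty_subset _, isAnalyticSet_empty, fun x hx =>
        ((regularLocus_subset (I := 𝓘(ℂ, A.model)) (∅ : Set A.carrier)) hx).elim⟩, ?_⟩
    · rw [Set.sdiff_empty]
      exact isConnected_univ
    · intro x _
      refine ⟨Set.univ, isOpen_univ, Set.mem_univ x, fun _ => 0, contMDiffOn_const, ?_, ?_, ?_⟩
      · ext y
        simp
      · intro y
        refine ⟨0, ?_⟩
        rw [map_zero]
        exact funext fun i => absurd i.2 (by omega)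
      · intro v _
        refine ⟨Literature.Geometry.Kaehler.tangentJ A.model x v, ?_, ?_⟩
        · exact funext fun i => absurd i.2 (by omega)
        · rw [sub_self, map_zero]
          exact mul_nonneg (sq_nonneg _) (riemannianMetric_inner_self_nonneg g.toRiemannianMetric x v)
  · -- the complement of `S = univ` is empty: no cohomology
    haveI : IsEmpty {x : A.carrier // x ∉ (Set.univ : Set A.carrier)} :=
      ⟨fun x => x.2 (Set.mem_univ _)⟩
    haveI := ModuleCat.subsingleton_of_isZero
      (isZero_singularCohomology_of_isEmpty (R := ℂ)
        (Y := {x : A.carrier // x ∉ (Set.univ : Set A.carrier)}) (2 * 0))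
    exact Subsingleton.elim _ _

/-- **The decomposition, closed form (no sorry): cancellation.** The two stub statements imply the
crux, stated with the crux UNFOLDED verbatim (so that only `RateGap_of` concludes the route decl by
name). For `p = 0`: `rateGap_conclusion_of_eq_zero`. For `0 < p ≤ n`: `c` is algebraic
(`mem_algebraicClasses_of_stub`: Lefschetz `(1,1)`, top degree, hard Lefschetz, and stub H at or below the middle), so with any smooth metric `g`
(`nonempty_contMDiffRiemannianMetric`), `m := 1`, `hp := -c` (rational: `IsRationalClass.smul`;
algebraic: `Submodule.neg_mem`), `C := 1`, `a k := min k 1`, `δ := 1`, `C' := 0`, the ray class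
`1•c + (min k 1)•(-c)` vanishes for every `k ≥ 1`, its pull-back and restriction are `0` (`map_zero`),
and the support is the holomorphic cycle support of stub G (defect `0·k^{-(p+1)}`), unfolded into the
route's inline predicate by `isNearlyHolomorphicCycleSupport_toRiemannianMetric_iff` (`Iff.rfl`).
Axioms: propext, Classical.choice, Quot.sound. -/
theorem RateGap_of_stubs
    (hG : ∀ (n p : ℕ) (X : Literature.AlgebraicGeometry.Motives.SchemeOver ℂ), Literature.AlgebraicGeometry.Motives.IsSmoothProjective n X → p ≤ n → 0 < p → ∀ (A : Literature.AlgebraicGeometry.HodgeTheory.HodgeModel n X) (g : Bundle.RiemannianMetric (fun x : A.carrier => TangentSpace 𝓘(ℝ, A.model) x)) (t : ℝ), ∃ S : Set A.carrier, Literature.Geometry.Kaehler.IsNearlyHolomorphicCycleSupport g p t S ∅)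
    (hH : ∀ (n p : ℕ) (X : Literature.AlgebraicGeometry.Motives.SchemeOver ℂ), Literature.AlgebraicGeometry.Motives.IsSmoothProjective n X → 2 ≤ p → 2 * p ≤ n → ∀ (A : Literature.AlgebraicGeometry.HodgeTheory.HodgeModel n X) (c : Literature.AlgebraicGeometry.HodgeTheory.complexBetti X (2 * p)), Literature.AlgebraicGeometry.HodgeTheory.IsRationalClass c → A.pullback (2 * p) c ∈ A.hodgePQ (2 * p) p p → c ∈ Literature.AlgebraicGeometry.HodgeTheory.algebraicClasses X p) :
    ∀ (n p : ℕ) (X : Literature.AlgebraicGeometry.Motives.SchemeOver ℂ), Literature.AlgebraicGeometry.Motives.IsSmoothProjective n X → p ≤ n → ∀ (A : Literature.AlgebraicGeometry.HodgeTheory.HodgeModel n X) (c : Literature.AlgebraicGeometry.HodgeTheory.complexBetti X (2 * p)), Literature.AlgebraicGeometry.HodgeTheory.IsRationalClass c → A.pullback (2 * p) c ∈ A.hodgePQ (2 * p) p p → ∃ (g : Bundle.ContMDiffRiemannianMetric 𝓘(ℝ, A.model) ((⊤ : ℕ∞) : WithTop ℕ∞) A.model (fun x : A.carrier => TangentSpace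 𝓘(ℝ, A.model) x)) (m : ℕ) (hp : Literature.AlgebraicGeometry.HodgeTheory.complexBetti X (2 * p)) (C : ℝ) (a : ℕ → ℕ) (δ C' : ℝ), 0 < m ∧ Literature.AlgebraicGeometry.HodgeTheory.IsRationalClass hp ∧ hp ∈ Literature.AlgebraicGeometry.HodgeTheory.algebraicClasses X p ∧ (∀ k, (a k : ℝ) ≤ C * (k : ℝ) ^ p) ∧ 0 < δ ∧ ∃ᶠ k : ℕ in Filter.atTop, ∃ S Sg : Set A.carrier, (IsClosed S ∧ IsClosed Sg ∧ Sg ⊆ S ∧ IsConnected (S \ Sg) ∧ (∀ x ∈ Sg, Literature.Geometry.Kaehler.IsAnalyticSetAt 𝓘(ℂ, A.model) S x) ∧ (∃ T : Set A.carrier, Sg ⊆ T ∧ (Literature.Geometry.Kaehler.IsAnalyticSet 𝓘(ℂ, A.model) T ∧ ∀ x ∈ Literature.Geometry.Kaehler.regularLocus 𝓘(ℂ, A.model) T, ∀ q : ℕ, Literature.Geometry.Kaehler.IsRegularPointOfCodim 𝓘(ℂ, A.model) T q x → p + 1 ≤ q)) ∧ (∀ x ∈ S \ Sg, ∃ U :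 Set A.carrier, IsOpen U ∧ x ∈ U ∧ ∃ f : A.carrier → (Fin (2 * p) → ℝ), ContMDiffOn 𝓘(ℝ, A.model) 𝓘(ℝ, Fin (2 * p) → ℝ) 1 f U ∧ S ∩ U = U ∩ f ⁻¹' {0} ∧ Function.Surjective (mfderiv 𝓘(ℝ, A.model) 𝓘(ℝ, Fin (2 * p) → ℝ) f x) ∧ ∀ v : TangentSpace 𝓘(ℝ, A.model) x, mfderiv 𝓘(ℝ, A.model) 𝓘(ℝ, Fin (2 * p) → ℝ) f x v = 0 → ∃ w : TangentSpace 𝓘(ℝ, A.model) x, mfderiv 𝓘(ℝ, A.model) 𝓘(ℝ, Fin (2 * p) → ℝ) f x w = 0 ∧ g.inner x (Literature.Geometry.Kaehler.tangentJ A.model x v - w) (Literature.Geometry.Kaehler.tangentJ A.model x v - w) ≤ (C' * (k : ℝ) ^ (-((p : ℝ) + δ))) ^ 2 * g.inner x v v)) ∧ Literature.AlgebraicTopology.SingularHomology.singularCohomology.map ℂ ℂ (⟨Subtype.val, continuous_subtype_val⟩ : C({x : A.carrier // x ∉ S}, A.carrier)) (2 * p) (A.pullback (2 * p) (((m : ℂ)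 • c + ((a k : ℕ) : ℂ) • hp))) = 0 := by
  intro n p X hX hpn A c hc hpp
  rcases Nat.eq_zero_or_pos p with hp0 | hp0
  · exact rateGap_conclusion_of_eq_zero n p X hX hp0 A c
  have halg : c ∈ Literature.AlgebraicGeometry.HodgeTheory.algebraicClasses X p :=
    mem_algebraicClasses_of_stub hH hX hpn hp0 A c hc hpp
  obtain ⟨g⟩ := Literature.Geometry.Riemannian.nonempty_contMDiffRiemannianMetric
    (I := 𝓘(ℝ, A.model)) (M := A.carrier)
  have hrat : Literature.AlgebraicGeometry.HodgeTheory.IsRationalClass (-c) := by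
    simpa using hc.smul (-1)
  refine ⟨g, 1, -c, 1, fun k => min k 1, 1, 0, one_pos, hrat, Submodule.neg_mem _ halg, ?_, one_pos, ?_⟩
  · -- the budget `a_k = min k 1 ≤ 1 · k^p`
    intro k
    show ((min k 1 : ℕ) : ℝ) ≤ 1 * (k : ℝ) ^ p
    rcases Nat.eq_zero_or_pos k with hk | hk
    · subst hk
      simp
    · rw [min_eq_right hk, Nat.cast_one, one_mul]
      exact one_le_pow₀ (by exact_mod_cast hk)
  · -- for every `k ≥ 1`: the holomorphic support of stub G and the vanishing ray class
    refine Filter.Eventually.frequently ((Filter.eventually_ge_atTop 1).mono fun k hk => ?_)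
    obtain ⟨S, hS⟩ := hG n p X hX hpn hp0 A g.toRiemannianMetric ((0 : ℝ) * (k : ℝ) ^ (-((p : ℝ) + 1)))
    refine ⟨S, ∅, (Literature.Geometry.Kaehler.isNearlyHolomorphicCycleSupport_toRiemannianMetric_iff g).1 hS, ?_⟩
    have h0 : (((1 : ℕ) : ℂ) • c + ((min k 1 : ℕ) : ℂ) • (-c)) = 0 := by
      rw [min_eq_right hk]
      simp
    rw [h0, map_zero, map_zero]

/-- **Skeleton theorem** — the crux `HolomorphicityRate.RateGap` BY NAME from the registered stubs
through the sorry-free composition `RateGap_of_stubs` (cancellation) and the sorry-free reductions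
`hodgePrimitiveMiddle_of_stub` (item 1081 ⟹ HC ⟹ primitive middle, lead c4),
`hodgeMiddle_of_stub` (primitive middle ⟹ middle: Lefschetz decomposition step, pencil step, hard
Lefschetz) and `hodgeBelowMiddle_of_stub` (middle ⟹ below the middle: BFNP Lemma 48). Sorries live
only inside `stub_middleDivisorSupport` (= item stmt-HodgeConjecture-1081 verbatim); stub G
`stub_existsHolomorphicCycleSupport` has landed (p143821), the reductions are the Theorems files
`HolomorphicityRateRateGapOfHodgeMiddle` (p151504), `HolomorphicityRateRateGapOfHodgePrimitive`
(p151989), `LinearSystemTorelliTranscendentalOrSupportedStubOfMiddleOfHodgeEffective` (p138214) and the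
c4 certificate `HolomorphicityRateRateGapOfMiddleDivisorSupport`. -/
theorem RateGap_of : Summit.HodgeConjecture.HodgeConjecture.Theses.HolomorphicityRate.RateGap :=
  RateGap_of_stubs stub_existsHolomorphicCycleSupport
    (hodgeBelowMiddle_of_stub (hodgeMiddle_of_stub (hodgePrimitiveMiddle_of_stub stub_middleDivisorSupport)))

end Summit.HodgeConjecture.HodgeConjecture.Cruxes.RateGap.Birth

end
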